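import Mathlib
import HarnessLib
import Summits.RiemannHypothesis.RiemannHypothesis.Theorems.IntegerScrewWalkTwoLevelsPrep

/-!
# Route `IntegerScrew` — TWO RUNGS: on the 3-dimensional space `span{1, φ₂, φ₃}` the truncated multiplicative walk has
# `E(g) ≤ ((λ_{3} + η)/L)·‖g‖²_π` for `log M ≥ 60/η` — by min–max, `−ℒ_M` has at least TWO eigenvalues `≤ λ_{3} + η`,
# `λ_{3} = (3/2)log 3`, in `t`-units (the `{2}` and `{3}` rungs of PIVOT-LAW 13.10 (iv) / CONTINUUM-LIMIT 23.18)

Ingredients (`IntegerScrewWalkTwoLevelsPrep`, `IntegerScrewParityDefect.walkGen_parity`, `IntegerScrewWalkDirichlet`):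
the exact eigen-relations `ℒ_Mφ_p = −λ_pφ_p + 𝟙[p ∤ x]·r_p(⌊M/x⌋)`, `Σ_{k≤M} r_p(⌊M/k⌋)/k ≤ λ_p`, the Gram entries
`‖φ₂‖² = H_M/4`, `‖φ₃‖² ≥ H_M/9`, `|⟨φ₂,φ₃⟩_π| ≤ 1/3`, the means `π(φ_p)² ≤ 1`, and a `2 × 2` positive-semidefiniteness
check.  `parityFun_two_three_indep`: the test space is 3-dimensional (`M ≥ 3`).  RH-free.  References: PIVOT-LAW
§13.10 (iv), CONTINUUM-LIMIT §23.18 (rh-explicit A6-PIVOT); M. Suzuki, J. Lond. Math. Soc. (2) 108 (2023) 1448–1487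
[Suzuki2023].
-/

noncomputable section

set_option linter.dupNamespace false -- D-0017: `Summit.<S>.<S>.…` is the designed namespace

namespace Summit.RiemannHypothesis.RiemannHypothesis.Theorems.IntegerScrew

open Finset ArithmeticFunction

/-! ### The two-rung theorem -/

/-- A `2 × 2` positive-semidefiniteness test: `A > 0`, `4AC ≥ β²` give `x²A + y²C − |x||y|β ≥ 0`. -/
theorem sq_form_nonneg_of_psd {A C β x y : ℝ} (hA : 0 < A) (h : β ^ 2 ≤ 4 * A * C) :
    0 ≤ x ^ 2 * A + y ^ 2 * C - |x| * |y| * β := by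
  have hx : x ^ 2 = |x| ^ 2 := (sq_abs x).symm
  have hy : y ^ 2 = |y| ^ 2 := (sq_abs y).symm
  rw [hx, hy]
  nlinarith [sq_nonneg (2 * A * |x| - β * |y|), mul_nonneg (sq_nonneg |y|) (sub_nonneg.2 h),
    abs_nonneg x, abs_nonneg y]

/-- `φ₂, φ₃, 1` are linearly independent on `{1, …, M}` (`M ≥ 3`): the test space below is 3-dimensional. -/
theorem parityFun_two_three_indep {M : ℕ} (hM : 3 ≤ M) {a b c : ℝ}
    (h : ∀ k : St M, a * parityFun 2 k + b * parityFun 3 k + c = 0) : a = 0 ∧ b = 0 ∧ c = 0 := by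
  have h1 := h ⟨1, Finset.mem_Icc.2 ⟨le_rfl, by omega⟩⟩
  have h2 := h ⟨2, Finset.mem_Icc.2 ⟨by norm_num, by omega⟩⟩
  have h3 := h ⟨3, Finset.mem_Icc.2 ⟨by norm_num, hM⟩⟩
  simp only at h1 h2 h3
  rw [parityFun_of_not_dvd (by norm_num : ¬ 2 ∣ 1), parityFun_of_not_dvd (by norm_num : ¬ 3 ∣ 1)] at h1
  rw [parityFun_of_dvd (dvd_refl 2), parityFun_of_not_dvd (by norm_num : ¬ 3 ∣ 2)] at h2
  rw [parityFun_of_not_dvd (by norm_num : ¬ 2 ∣ 3), parityFun_of_dvd (dvd_refl 3)] at h3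
  push_cast at h1 h2 h3
  refine ⟨by linarith, by linarith, by linarith⟩

/-- **TWO RUNGS.**  For `0 < η ≤ 1` and `log M ≥ 60/η`, every `g` in the 3-dimensional space `span{1, φ₂, φ₃}` has
`E(g) ≤ ((3 log 3/2 + η)/log M)·‖g‖²_π`.  By the min–max principle for the `π`-self-adjoint `−walkGen M ≥ 0`
(`IntegerScrewWalkDirichlet`, `IntegerScrewWalkErgodic`), `−walkGen M` has at least two eigenvalues (counted from the
simple eigenvalue `0`) in `(0, (λ_{3} + η)/log M]`, `λ_{3} = (3/2)log 3 = 1.648`: in `t`-units the truncated walk has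
(at least) the TWO slow levels `≤ λ_{2}` (indeed `< 2 log 2`, `walk_gap_lt`) and `≤ λ_{3} + η` predicted by the
prime-parity ladder (PIVOT-LAW 13.10 (iv); CONTINUUM-LIMIT 23.18).  The threshold is asymptotic only (the cross terms
`⟨φ₂,φ₃⟩_π`, `⟨φ₂, r₃⟩`, `⟨φ₃, r₂⟩ = O(1)` are bounded crudely against the `O(H_M)` diagonal). -/
theorem walk_two_levels {η : ℝ} (hη : 0 < η) (hη1 : η ≤ 1) {M : ℕ} (hM : 60 / η ≤ Real.log M) (a b c : ℝ) :
    -(∑ k : St M, (a * parityFun 2 k + b * parityFun 3 k + c) / (k : ℕ) *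
        ∑ j : St M, walkGen M k j * (a * parityFun 2 j + b * parityFun 3 j + c)) ≤
      ((3 * Real.log 3 / 2 + η) / Real.log M) *
        ∑ k : St M, (a * parityFun 2 k + b * parityFun 3 k + c) ^ 2 / (k : ℕ) := by
  -- sizes: log M ≥ 60, so M ≥ 6 and L > 0
  have h60 : (60 : ℝ) ≤ 60 / η := by rw [le_div_iff₀ hη]; linarith only [hη1]
  have hL60 : (60 : ℝ) ≤ Real.log M := h60.trans hM
  have hM6 : 6 ≤ M := by
    by_contra hlt
    have hM6' : (M : ℝ) ≤ 6 := by exact_mod_cast (show M ≤ 6 by omega)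
    have h1 : Real.log (M : ℝ) ≤ Real.log 6 := by
      rcases Nat.eq_zero_or_pos M with h0 | h0
      · rw [h0]; simp; exact Real.log_nonneg (by norm_num)
      · exact Real.log_le_log (by exact_mod_cast h0) hM6'
    have h2 : Real.log (6 : ℝ) ≤ 6 - 1 := by linarith [Real.log_le_sub_one_of_pos (by norm_num : (0 : ℝ) < 6)]
    linarith
  have hM1 : 1 ≤ M := by omega
  have hM0 : (0 : ℝ) < M := by exact_mod_cast (show 0 < M by omega)
  set L : ℝ := Real.log M with hLdef
  have hL : 0 < L := by linarith only [hL60]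
  -- notation
  set φ₂ : St M → ℝ := fun k => parityFun 2 k with hφ₂
  set φ₃ : St M → ℝ := fun k => parityFun 3 k with hφ₃
  set D₂ : St M → ℝ := fun k => if 2 ∣ (k : ℕ) then 0 else
    (Real.log 2 / ((2 : ℝ) - 1) - ∑ n ∈ (Icc 1 (M / k)).filter (fun n => 2 ∣ n), (Λ n : ℝ) / n) with hD₂
  set D₃ : St M → ℝ := fun k => if 3 ∣ (k : ℕ) then 0 else
    (Real.log 3 / ((3 : ℝ) - 1) - ∑ n ∈ (Icc 1 (M / k)).filter (fun n => 3 ∣ n), (Λ n : ℝ) / n) with hD₃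
  set lam2 : ℝ := (2 : ℝ) * Real.log 2 / ((2 : ℝ) - 1) with hlam2
  set lam3 : ℝ := (3 : ℝ) * Real.log 3 / ((3 : ℝ) - 1) with hlam3
  set H : ℝ := ∑ k : St M, (1 : ℝ) / (k : ℕ) with hHdef
  set N22 : ℝ := ∑ k : St M, φ₂ k ^ 2 / (k : ℕ) with hN22
  set N33 : ℝ := ∑ k : St M, φ₃ k ^ 2 / (k : ℕ) with hN33
  set N23 : ℝ := ∑ k : St M, φ₂ k * φ₃ k / (k : ℕ) with hN23
  set S2 : ℝ := ∑ k : St M, φ₂ k / (k : ℕ) with hS2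
  set S3 : ℝ := ∑ k : St M, φ₃ k / (k : ℕ) with hS3
  set X2 : ℝ := ∑ k : St M, φ₂ k * D₂ k / (k : ℕ) with hX2
  set X3 : ℝ := ∑ k : St M, φ₃ k * D₃ k / (k : ℕ) with hX3
  set Y23 : ℝ := ∑ k : St M, φ₂ k * D₃ k / (k : ℕ) with hY23
  set Y32 : ℝ := ∑ k : St M, φ₃ k * D₂ k / (k : ℕ) with hY32
  show -(∑ k : St M, (a * φ₂ k + b * φ₃ k + c) / (k : ℕ) *
      ∑ j : St M, walkGen M k j * (a * φ₂ j + b * φ₃ j + c)) ≤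
    ((3 * Real.log 3 / 2 + η) / L) * ∑ k : St M, (a * φ₂ k + b * φ₃ k + c) ^ 2 / (k : ℕ)
  -- make the abbreviations opaque (their defining equations stay): keeps `ring`/`linarith` fast
  clear_value L φ₂ φ₃ D₂ D₃ lam2 lam3 H N22 N33 N23 S2 S3 X2 X3 Y23 Y32
  -- ℕ-indexed versions of the Gram entries / means, and their bounds
  have hHI : ∑ m ∈ Icc 1 M, (1 : ℝ) / m = H := by
    rw [hHdef, Finset.sum_coe_sort (Finset.Icc 1 M) (fun k => (1 : ℝ) / k)]
  have hH60 : 60 / η ≤ H := by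
    have h := log_succ_le_harmonicSum M
    rw [hHI] at h
    have hM' := hM
    rw [hLdef] at hM'
    exact hM'.trans ((Real.log_le_log hM0 (by linarith only [hM0])).trans h)
  have hH60' : 60 ≤ H := h60.trans hH60
  have hH0 : 0 < H := by linarith only [hH60']
  have hN22v : N22 = H / 4 := by
    rw [hN22, ← hHI, ← sum_parityFun_two_sq_div M]; simp only [hφ₂]
    exact Finset.sum_coe_sort (Finset.Icc 1 M) (fun k : ℕ => parityFun 2 k ^ 2 / (k : ℝ))
  have hN33v : H / 9 ≤ N33 := by
    rw [hN33, ← hHI]; simp only [hφ₃]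
    rw [Finset.sum_coe_sort (Finset.Icc 1 M) (fun k : ℕ => parityFun 3 k ^ 2 / (k : ℝ))]
    exact sum_parityFun_three_sq_div_ge M
  have hN23v : |N23| ≤ 1 / 3 := by
    rw [hN23]; simp only [hφ₂, hφ₃]
    rw [Finset.sum_coe_sort (Finset.Icc 1 M) (fun k : ℕ => parityFun 2 k * parityFun 3 k / (k : ℝ))]
    exact abs_sum_parityFun_two_mul_three_div_le hM6
  have hS2v : S2 ^ 2 ≤ 1 := by
    rw [hS2]; simp only [hφ₂]
    rw [Finset.sum_coe_sort (Finset.Icc 1 M) (fun k : ℕ => parityFun 2 k / (k : ℝ))]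
    exact sum_parityFun_div_sq_le_one Nat.prime_two hM1
  have hS3v : S3 ^ 2 ≤ 1 := by
    rw [hS3]; simp only [hφ₃]
    rw [Finset.sum_coe_sort (Finset.Icc 1 M) (fun k : ℕ => parityFun 3 k / (k : ℝ))]
    exact sum_parityFun_div_sq_le_one Nat.prime_three hM1
  -- defect terms: D ≥ 0, D ≤ r, Σ r/k ≤ λ
  have hD₂b : ∀ k : St M, 0 ≤ D₂ k ∧ D₂ k ≤ Real.log 2 / ((2 : ℝ) - 1) -
      ∑ n ∈ (Icc 1 (M / k)).filter (fun n => 2 ∣ n), (Λ n : ℝ) / n := by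
    intro k
    have hnn := parityDefect_nonneg Nat.prime_two (M / k)
    push_cast at hnn
    rw [hD₂]; dsimp only
    by_cases h2 : 2 ∣ (k : ℕ)
    · rw [if_pos h2]; exact ⟨le_rfl, hnn⟩
    · rw [if_neg h2]; exact ⟨hnn, le_rfl⟩
  have hD₃b : ∀ k : St M, 0 ≤ D₃ k ∧ D₃ k ≤ Real.log 3 / ((3 : ℝ) - 1) -
      ∑ n ∈ (Icc 1 (M / k)).filter (fun n => 3 ∣ n), (Λ n : ℝ) / n := by
    intro k
    have hnn := parityDefect_nonneg Nat.prime_three (M / k)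
    push_cast at hnn
    rw [hD₃]; dsimp only
    by_cases h3 : 3 ∣ (k : ℕ)
    · rw [if_pos h3]; exact ⟨le_rfl, hnn⟩
    · rw [if_neg h3]; exact ⟨hnn, le_rfl⟩
  have hsumD2 : ∑ k : St M, D₂ k / (k : ℕ) ≤ lam2 := by
    have h := sum_parityDefect_div_le Nat.prime_two hM1
    push_cast at h
    rw [← Finset.sum_coe_sort (Finset.Icc 1 M)] at h
    refine le_trans (Finset.sum_le_sum fun k _ => ?_) (h.trans (le_of_eq ?_))
    · exact div_le_div_of_nonneg_right (hD₂b k).2 (Nat.cast_nonneg _)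
    · rw [hlam2]
  have hsumD3 : ∑ k : St M, D₃ k / (k : ℕ) ≤ lam3 := by
    have h := sum_parityDefect_div_le Nat.prime_three hM1
    push_cast at h
    rw [← Finset.sum_coe_sort (Finset.Icc 1 M)] at h
    refine le_trans (Finset.sum_le_sum fun k _ => ?_) (h.trans (le_of_eq ?_))
    · exact div_le_div_of_nonneg_right (hD₃b k).2 (Nat.cast_nonneg _)
    · rw [hlam3]
  -- |φ₂| = 1/2, |φ₃| ≤ 2/3, φ_q > 0 where D_q ≠ 0
  have hφ₂abs : ∀ k : St M, |φ₂ k| = 1 / 2 := by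
    intro k; rw [hφ₂]; dsimp only
    by_cases h2 : 2 ∣ (k : ℕ)
    · rw [parityFun_of_dvd h2]; norm_num
    · rw [parityFun_of_not_dvd h2]; norm_num
  have hφ₃abs : ∀ k : St M, |φ₃ k| ≤ 2 / 3 := by
    intro k; rw [hφ₃]; dsimp only
    by_cases h3 : 3 ∣ (k : ℕ)
    · rw [parityFun_of_dvd h3]; norm_num
    · rw [parityFun_of_not_dvd h3]; norm_num
  have hX2nn : 0 ≤ X2 := by
    rw [hX2]; refine Finset.sum_nonneg fun k _ => div_nonneg ?_ (Nat.cast_nonneg _)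
    have h0 := (hD₂b k).1
    by_cases h2 : 2 ∣ (k : ℕ)
    · have hz : D₂ k = 0 := by rw [hD₂]; dsimp only; rw [if_pos h2]
      rw [hz, mul_zero]
    · have hφ : 0 ≤ φ₂ k := by rw [hφ₂]; dsimp only; rw [parityFun_of_not_dvd h2]; positivity
      exact mul_nonneg hφ h0
  have hX3nn : 0 ≤ X3 := by
    rw [hX3]; refine Finset.sum_nonneg fun k _ => div_nonneg ?_ (Nat.cast_nonneg _)
    have h0 := (hD₃b k).1
    by_cases h3 : 3 ∣ (k : ℕ)
    · have hz : D₃ k = 0 := by rw [hD₃]; dsimp only; rw [if_pos h3]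
      rw [hz, mul_zero]
    · have hφ : 0 ≤ φ₃ k := by rw [hφ₃]; dsimp only; rw [parityFun_of_not_dvd h3]; positivity
      exact mul_nonneg hφ h0
  have hY23b : |Y23| ≤ (1 / 2) * lam3 := by
    rw [hY23]
    refine (Finset.abs_sum_le_sum_abs _ _).trans ?_
    calc ∑ k : St M, |φ₂ k * D₃ k / ((k : ℕ) : ℝ)| = ∑ k : St M, (1 / 2) * (D₃ k / (k : ℕ)) := by
          refine Finset.sum_congr rfl fun k _ => ?_
          rw [abs_div, abs_mul, hφ₂abs k, abs_of_nonneg (hD₃b k).1, Nat.abs_cast]; ring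
      _ = (1 / 2) * ∑ k : St M, D₃ k / (k : ℕ) := by rw [Finset.mul_sum]
      _ ≤ (1 / 2) * lam3 := mul_le_mul_of_nonneg_left hsumD3 (by norm_num)
  have hY32b : |Y32| ≤ (2 / 3) * lam2 := by
    rw [hY32]
    refine (Finset.abs_sum_le_sum_abs _ _).trans ?_
    calc ∑ k : St M, |φ₃ k * D₂ k / ((k : ℕ) : ℝ)| ≤ ∑ k : St M, (2 / 3) * (D₂ k / (k : ℕ)) := by
          refine Finset.sum_le_sum fun k _ => ?_
          rw [abs_div, abs_mul, abs_of_nonneg (hD₂b k).1, Nat.abs_cast, mul_div_assoc]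
          exact mul_le_mul_of_nonneg_right (hφ₃abs k) (div_nonneg (hD₂b k).1 (Nat.cast_nonneg _))
      _ = (2 / 3) * ∑ k : St M, D₂ k / (k : ℕ) := by rw [Finset.mul_sum]
      _ ≤ (2 / 3) * lam2 := mul_le_mul_of_nonneg_left hsumD2 (by norm_num)
  -- numerics: lam2 = 2 log 2 ∈ (1.386, 1.3864), lam3 = (3/2) log 3 with log 3 ∈ [log 2 + 1/3, log 2 + 1/2]
  have hl2a := Real.log_two_gt_d9
  have hl2b := Real.log_two_lt_d9
  have hlog32 : Real.log 3 = Real.log 2 + Real.log (3 / 2) := by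
    rw [← Real.log_mul (by norm_num) (by norm_num)]; norm_num
  have hl3a : Real.log 2 + 1 / 3 ≤ Real.log 3 := by
    have h := Real.one_sub_inv_le_log_of_pos (show (0 : ℝ) < 3 / 2 by norm_num)
    rw [hlog32]; norm_num at h ⊢; linarith
  have hl3b : Real.log 3 ≤ Real.log 2 + 1 / 2 := by
    have h := Real.log_le_sub_one_of_pos (show (0 : ℝ) < 3 / 2 by norm_num)
    rw [hlog32]; norm_num at h ⊢; linarith
  have hlam2v : lam2 = 2 * Real.log 2 := by rw [hlam2]; norm_num
  have hlam3v : lam3 = 3 * Real.log 3 / 2 := by rw [hlam3]; norm_num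
  norm_num at hl2a hl2b
  have hδ : 0.153 ≤ lam3 - lam2 := by rw [hlam2v, hlam3v]; norm_num; linarith only [hl2a, hl2b, hl3a]
  have hlam3le : lam3 ≤ 1.79 := by rw [hlam3v]; norm_num; linarith only [hl2b, hl3b]
  have hlam2le : lam2 ≤ 1.3864 := by rw [hlam2v]; norm_num; linarith only [hl2b]
  have hlam2ge : 1.386 ≤ lam2 := by rw [hlam2v]; norm_num; linarith only [hl2a]
  have hinvH : 1 / H ≤ η / 60 := by
    rw [div_le_div_iff₀ hH0 (by norm_num)]
    have := (div_le_iff₀ hη).1 hH60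
    linarith only [this]
  -- the 2×2 form: A = (λ₃+η−λ₂)N₂₂ − 2(λ₃+η)/H, C = ηN₃₃ − 2(λ₃+η)/H, β = cross-term bound
  set A : ℝ := (lam3 + η - lam2) * N22 - 2 * (lam3 + η) / H with hA
  set C : ℝ := η * N33 - 2 * (lam3 + η) / H with hC
  set β : ℝ := (1 / 2) * lam3 + (2 / 3) * lam2 + (lam3 - lam2 + 2 * η) * (1 / 3) with hβ
  have h2H : 2 * (lam3 + η) / H ≤ 2 * (1.79 + 1) * (η / 60) := by
    rw [div_eq_mul_one_div]
    exact mul_le_mul (by linarith only [hlam3le, hη1]) hinvH (by positivity) (by norm_num)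
  have hAlb : 0.03 * H ≤ A := by
    have h1 : (0.153 + η) * (H / 4) ≤ (lam3 + η - lam2) * N22 := by
      rw [hN22v]; exact mul_le_mul_of_nonneg_right (by linarith only [hδ]) (by positivity)
    have h3 : 0 ≤ η * H := by positivity
    rw [hA]; norm_num at h1 h2H ⊢; linarith only [h1, h2H, h3, hH60', hη1]
  have hClb : 0.1 * η * H ≤ C := by
    have h1 : η * (H / 9) ≤ η * N33 := mul_le_mul_of_nonneg_left hN33v hη.le
    have h4 : η * 60 ≤ η * H := mul_le_mul_of_nonneg_left hH60' hη.le
    rw [hC]; norm_num at h1 h2H ⊢; linarith only [h1, h2H, h4, hη]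
  have hA0 : 0 < A := lt_of_lt_of_le (mul_pos (by norm_num) hH0) hAlb
  have hβb : β ≤ 2.7 ∧ 0 ≤ β := by
    rw [hβ]; norm_num at hlam3le hlam2le hlam2ge hδ ⊢
    constructor
    · linarith only [hlam3le, hlam2le, hlam2ge, hδ, hη1]
    · linarith only [hlam3le, hlam2le, hlam2ge, hδ, hη]
  have hPSD : β ^ 2 ≤ 4 * A * C := by
    have h1 : β ^ 2 ≤ 2.7 ^ 2 := pow_le_pow_left₀ hβb.2 hβb.1 2
    have h2 : 60 ≤ η * H := by have := (div_le_iff₀ hη).1 hH60; linarith only [this]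
    have hC0 : 0 ≤ 0.1 * η * H := by positivity
    have h3 : 4 * (0.03 * H) * (0.1 * η * H) ≤ 4 * A * C :=
      mul_le_mul (mul_le_mul_of_nonneg_left hAlb (by norm_num)) hClb hC0 (by positivity)
    have h4 : (60 : ℝ) * 60 ≤ η * H * H := mul_le_mul h2 hH60' (by norm_num) (by positivity)
    norm_num at h1 h3 ⊢
    linarith only [h1, h3, h4]
  have hform := sq_form_nonneg_of_psd (x := a) (y := b) hA0 hPSD
  -- cross terms
  have hcross : |a * b * (Y23 + Y32)| ≤ |a| * |b| * ((1 / 2) * lam3 + (2 / 3) * lam2) := by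
    rw [abs_mul, abs_mul]
    exact mul_le_mul_of_nonneg_left ((abs_add_le _ _).trans (add_le_add hY23b hY32b)) (by positivity)
  have hN23t : |a * b * ((lam3 - lam2 + 2 * η) * N23)| ≤ |a| * |b| * ((lam3 - lam2 + 2 * η) * (1 / 3)) := by
    rw [abs_mul, abs_mul, abs_mul, abs_of_nonneg (show 0 ≤ lam3 - lam2 + 2 * η by linarith only [hδ, hη])]
    exact mul_le_mul_of_nonneg_left (mul_le_mul_of_nonneg_left hN23v (by linarith only [hδ, hη])) (by positivity)
  have hc1 := abs_le.1 hcross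
  have hc2 := abs_le.1 hN23t
  -- pure arithmetic: the main comparison, and the completion of the square in c
  have hmain : (a ^ 2 * lam2 * N22 + a * b * (lam2 + lam3) * N23 + b ^ 2 * lam3 * N33) -
      (a ^ 2 * X2 + a * b * (Y23 + Y32) + b ^ 2 * X3) ≤
      (lam3 + η) * (a ^ 2 * N22 + 2 * a * b * N23 + b ^ 2 * N33 - 2 * (a ^ 2 + b ^ 2) / H) := by
    have e : (lam3 + η) * (a ^ 2 * N22 + 2 * a * b * N23 + b ^ 2 * N33 - 2 * (a ^ 2 + b ^ 2) / H) -
        ((a ^ 2 * lam2 * N22 + a * b * (lam2 + lam3) * N23 + b ^ 2 * lam3 * N33) +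
          |a| * |b| * ((1 / 2) * lam3 + (2 / 3) * lam2)) =
        (a ^ 2 * A + b ^ 2 * C - |a| * |b| * β) + (a * b * ((lam3 - lam2 + 2 * η) * N23) +
          |a| * |b| * ((lam3 - lam2 + 2 * η) * (1 / 3))) := by
      rw [hA, hC, hβ]; ring
    have hsq : 0 ≤ a ^ 2 * X2 + b ^ 2 * X3 :=
      add_nonneg (mul_nonneg (sq_nonneg a) hX2nn) (mul_nonneg (sq_nonneg b) hX3nn)
    linarith only [e, hform, hc1.1, hc2.1, hsq]
  have haux : a ^ 2 * N22 + 2 * a * b * N23 + b ^ 2 * N33 - 2 * (a ^ 2 + b ^ 2) / H ≤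
      a ^ 2 * N22 + 2 * a * b * N23 + b ^ 2 * N33 + 2 * c * (a * S2 + b * S3) + c ^ 2 * H := by
    have hT : (a * S2 + b * S3) ^ 2 ≤ 2 * (a ^ 2 + b ^ 2) := by
      have h1 : (a * S2 + b * S3) ^ 2 ≤ 2 * ((a * S2) ^ 2 + (b * S3) ^ 2) := by
        nlinarith only [sq_nonneg (a * S2 - b * S3)]
      have h2 : (a * S2) ^ 2 ≤ a ^ 2 := by
        calc (a * S2) ^ 2 = a ^ 2 * S2 ^ 2 := by ring
          _ ≤ a ^ 2 * 1 := mul_le_mul_of_nonneg_left hS2v (sq_nonneg a)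
          _ = a ^ 2 := mul_one _
      have h3 : (b * S3) ^ 2 ≤ b ^ 2 := by
        calc (b * S3) ^ 2 = b ^ 2 * S3 ^ 2 := by ring
          _ ≤ b ^ 2 * 1 := mul_le_mul_of_nonneg_left hS3v (sq_nonneg b)
          _ = b ^ 2 := mul_one _
      linarith only [h1, h2, h3]
    have hc : -((a * S2 + b * S3) ^ 2) / H ≤ 2 * c * (a * S2 + b * S3) + c ^ 2 * H := by
      rw [div_le_iff₀ hH0]
      have e : (2 * c * (a * S2 + b * S3) + c ^ 2 * H) * H =
          (c * H + (a * S2 + b * S3)) ^ 2 - (a * S2 + b * S3) ^ 2 := by ring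
      rw [e]
      linarith only [sq_nonneg (c * H + (a * S2 + b * S3))]
    have h4 : (a * S2 + b * S3) ^ 2 / H ≤ 2 * (a ^ 2 + b ^ 2) / H := div_le_div_of_nonneg_right hT hH0.le
    rw [neg_div] at hc
    linarith only [hc, h4]
  have hpos : 0 ≤ lam3 + η := by linarith only [hδ, hlam2ge, hη]
  -- the rows of the generator on φ₂, φ₃ (exact eigen-relations with defect)
  have hrow2 : ∀ k : St M, ∑ j : St M, walkGen M k j * φ₂ j = -(lam2 / L) * φ₂ k + (1 / L) * D₂ k := by
    intro k
    have h := walkGen_parity (M := M) Nat.prime_two k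
    rw [hφ₂, hD₂, hlam2, hLdef]; push_cast at h ⊢; exact h
  have hrow3 : ∀ k : St M, ∑ j : St M, walkGen M k j * φ₃ j = -(lam3 / L) * φ₃ k + (1 / L) * D₃ k := by
    intro k
    have h := walkGen_parity (M := M) Nat.prime_three k
    rw [hφ₃, hD₃, hlam3, hLdef]; push_cast at h ⊢; exact h
  -- the generator on g = aφ₂ + bφ₃ (+ c)
  have hshift := dirichlet_add_const M (fun k => a * φ₂ k + b * φ₃ k) c
  have hGg : ∀ k : St M, ∑ j : St M, walkGen M k j * (a * φ₂ j + b * φ₃ j) =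
      a * (-(lam2 / L) * φ₂ k + (1 / L) * D₂ k) + b * (-(lam3 / L) * φ₃ k + (1 / L) * D₃ k) := by
    intro k
    rw [← hrow2 k, ← hrow3 k, Finset.mul_sum, Finset.mul_sum, ← Finset.sum_add_distrib]
    exact Finset.sum_congr rfl fun j _ => by ring
  -- the quadratic form Q = Σ (g/k)(G g) in closed form
  have hQ : ∑ k : St M, (a * φ₂ k + b * φ₃ k) / (k : ℕ) * ∑ j : St M, walkGen M k j * (a * φ₂ j + b * φ₃ j) =
      -(1 / L) * (a ^ 2 * lam2 * N22 + a * b * (lam2 + lam3) * N23 + b ^ 2 * lam3 * N33) +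
        (1 / L) * (a ^ 2 * X2 + a * b * (Y23 + Y32) + b ^ 2 * X3) := by
    have e : ∀ k : St M, (a * φ₂ k + b * φ₃ k) / (k : ℕ) * ∑ j : St M, walkGen M k j * (a * φ₂ j + b * φ₃ j) =
        (-(1 / L) * a ^ 2 * lam2) * (φ₂ k ^ 2 / (k : ℕ)) + (-(1 / L) * a * b * (lam2 + lam3)) * (φ₂ k * φ₃ k / (k : ℕ)) +
          (-(1 / L) * b ^ 2 * lam3) * (φ₃ k ^ 2 / (k : ℕ)) +
        ((1 / L) * a ^ 2) * (φ₂ k * D₂ k / (k : ℕ)) + ((1 / L) * a * b) * (φ₂ k * D₃ k / (k : ℕ)) +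
          ((1 / L) * a * b) * (φ₃ k * D₂ k / (k : ℕ)) + ((1 / L) * b ^ 2) * (φ₃ k * D₃ k / (k : ℕ)) := by
      intro k; rw [hGg k]; ring
    rw [Finset.sum_congr rfl fun k _ => e k, hN22, hN23, hN33, hX2, hX3, hY23, hY32]
    simp only [Finset.sum_add_distrib, ← Finset.mul_sum]
    ring
  -- the norm in closed form
  have hnorm : ∑ k : St M, (a * φ₂ k + b * φ₃ k + c) ^ 2 / ((k : ℕ) : ℝ) =
      a ^ 2 * N22 + 2 * a * b * N23 + b ^ 2 * N33 + 2 * c * (a * S2 + b * S3) + c ^ 2 * H := by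
    have e : ∀ k : St M, (a * φ₂ k + b * φ₃ k + c) ^ 2 / ((k : ℕ) : ℝ) =
        a ^ 2 * (φ₂ k ^ 2 / (k : ℕ)) + (2 * a * b) * (φ₂ k * φ₃ k / (k : ℕ)) + b ^ 2 * (φ₃ k ^ 2 / (k : ℕ)) +
          (2 * c * a) * (φ₂ k / (k : ℕ)) + (2 * c * b) * (φ₃ k / (k : ℕ)) + c ^ 2 * (1 / (k : ℕ)) := by
      intro k; ring
    rw [Finset.sum_congr rfl fun k _ => e k, hN22, hN23, hN33, hS2, hS3, hHdef]
    simp only [Finset.sum_add_distrib, ← Finset.mul_sum]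
    ring
  -- assemble
  rw [hshift, hQ, hnorm]
  have hfin : (a ^ 2 * lam2 * N22 + a * b * (lam2 + lam3) * N23 + b ^ 2 * lam3 * N33) -
      (a ^ 2 * X2 + a * b * (Y23 + Y32) + b ^ 2 * X3) ≤
      (3 * Real.log 3 / 2 + η) * (a ^ 2 * N22 + 2 * a * b * N23 + b ^ 2 * N33 + 2 * c * (a * S2 + b * S3) + c ^ 2 * H) := by
    rw [← hlam3v]
    exact hmain.trans (mul_le_mul_of_nonneg_left haux hpos)
  have e1 : -( -(1 / L) * (a ^ 2 * lam2 * N22 + a * b * (lam2 + lam3) * N23 + b ^ 2 * lam3 * N33) +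
      1 / L * (a ^ 2 * X2 + a * b * (Y23 + Y32) + b ^ 2 * X3)) =
      ((a ^ 2 * lam2 * N22 + a * b * (lam2 + lam3) * N23 + b ^ 2 * lam3 * N33) -
        (a ^ 2 * X2 + a * b * (Y23 + Y32) + b ^ 2 * X3)) / L := by
    rw [div_eq_mul_one_div]; ring
  have e2 : (3 * Real.log 3 / 2 + η) / L *
      (a ^ 2 * N22 + 2 * a * b * N23 + b ^ 2 * N33 + 2 * c * (a * S2 + b * S3) + c ^ 2 * H) =
      ((3 * Real.log 3 / 2 + η) *
        (a ^ 2 * N22 + 2 * a * b * N23 + b ^ 2 * N33 + 2 * c * (a * S2 + b * S3) + c ^ 2 * H)) / L := by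
    ring
  rw [e1, e2]
  exact div_le_div_of_nonneg_right hfin hL.le

end Summit.RiemannHypothesis.RiemannHypothesis.Theorems.IntegerScrew

end
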